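/-
Copyright (c) 2026. All rights reserved.
Released under Apache 2.0 license as described in the file LICENSE.
Authors: abc-iut cell, wave-2 seat abc-iut-L3-t11 (G31 conjunct (5): [SemiAnbd] Example 2.10, verticial
slimness, reduced to the slimness of pro-Σ surface groups).
-/
import Literature.AnabelianGeometry.SemiGraphs.Coverticial
import HarnessLib

/-!
# [SemiAnbd] Example 2.10, conjunct (5): a semi-graph of anabelioids of surface type is verticially slim

Mochizuki, *Semi-graphs of anabelioids*, Publ. RIMS **42** (2006) [MochizukiSemiAnbd2006], Example 2.10
p. 31: a semi-graph of anabelioids of surface type (dual semi-graph of a pointed stable curve, vertex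
groups = pro-`Σ` fundamental groups of hyperbolic curves, branches attached through cusp inertia) "is …
verticially slim [cf. the proof of [Mzk3], Lemma 1.3.1]" — typed by abc-iut-L3-t1 as the last conjunct of
the named fact `SemiGraphOfAnabelioids.example_2_10` over the interface `IsOfSurfaceType Sigma`
(`Coverticial.lean`).

The group-theoretic content print points to is [Mzk3] = [AbsAnab] (Mochizuki, *The absolute anabelian
geometry of hyperbolic curves*, 2004) Lemma 1.3.1, proof: **the pro-`Σ` completion of the fundamental group
of a hyperbolic surface of type `(g, r)` is slim** (every open subgroup has trivial centraliser; for
`r ≥ 1` a free pro-`Σ` group of rank `2g + r − 1 ≥ 2`, for `r = 0` a pro-`Σ` surface group of genus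
`≥ 2`). It is recorded here ONCE as the named fact `ProSigmaSurfaceGroupSlim` (in the vocabulary of
`Coverticial.lean`: `PuncturedSurfaceGroup g r`, `IsHyperbolicType`, `IsProSigmaCompletion Sigma ι`,
`IsSlimGroup`), and conjunct (5) of Example 2.10 is PROVED from it (`example_2_10_verticiallySlim_of`):
each vertex anabelioid `𝒢_v` has, at every basepoint `F`, fundamental group `Aut F` a pro-`Σ` completion
of a hyperbolic punctured surface group (`IsOfSurfaceType.vertex`), hence slim.

In-tree partial evidence for the named fact (not used here): abc-iut-L5's [IUTchI] §2 chain proves the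
centraliser condition and `Z_{Ĝ}(Ker(Ĝ ↠ Ĝ^{ab})) = 1` for PROFINITE completions of FREE groups of
finite rank (`Literature.IUT.HodgeTheaters.DiscreteProfiniteCompletionsAssembly`,
`centralizerCommutatorKernelTrivial_freeCase`); the pro-`Σ` / closed-surface cases are not in the tree.
One definition (the named fact); nothing here bears on [IUTchIII] Cor. 3.12.
-/

namespace Literature.AnabelianGeometry.SemiGraphs

open CategoryTheory PreGaloisCategory
open Literature.GroupTheory.CombinatorialGroupTheory Literature.AlgebraicGeometry.Frobenioids

universe w v₁ u₁ u

/-- **Slimness of pro-`Σ` surface groups** ([AbsAnab] = [Mzk3] Lemma 1.3.1, proof; the fact [SemiAnbd]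
Ex. 2.10 p. 31 invokes for "verticially slim"): for a nonempty set of primes `Σ` and a hyperbolic type
`(g, r)` (`2g − 2 + r > 0`), every pro-`Σ` completion `ι : π₁(S_{g,r}) → P` (dense image, open normal
subgroups of `Σ`-index, universal for finite `Σ`-quotients) of the punctured surface group into a
profinite group `P` is SLIM: the centraliser of every open subgroup of `P` is trivial. Named fact, not
proved here. [cite: MochizukiAbsAnab2004, Lemma 1.3.1 p.15] -/
def ProSigmaSurfaceGroupSlim : Prop :=
  ∀ (Sigma : Set ℕ), Sigma.Nonempty → (∀ p ∈ Sigma, p.Prime) →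
    ∀ (g r : ℕ), PuncturedSurfaceGroup.IsHyperbolicType g r →
      ∀ (P : Type w) [Group P] [TopologicalSpace P] [IsTopologicalGroup P] [CompactSpace P]
        [T2Space P] [TotallyDisconnectedSpace P] (ι : PuncturedSurfaceGroup g r →* P),
        SemiGraphOfAnabelioids.IsProSigmaCompletion Sigma ι → IsSlimGroup P

namespace SemiGraphOfAnabelioids

/-- **[SemiAnbd] Example 2.10, conjunct (5), PROVED from `ProSigmaSurfaceGroupSlim`**: a semi-graph of
anabelioids of surface type is verticially slim — at every vertex `v` and every basepoint `F` of `𝒢_v`,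
`π₁(𝒢_v, F) = Aut F` is a pro-`Σ` completion of a hyperbolic punctured surface group
(`IsOfSurfaceType.vertex`), hence slim. [cite: MochizukiSemiAnbd2006, Ex. 2.10 p.31] -/
theorem example_2_10_verticiallySlim_of (h : ProSigmaSurfaceGroupSlim.{max u₁ v₁})
    (𝒢 : SemiGraphOfAnabelioids.{v₁, u₁, u}) (Sigma : Set ℕ) (hS : 𝒢.IsOfSurfaceType Sigma) :
    𝒢.IsVerticiallySlim := by
  refine ⟨fun v => ⟨fun F _ => ?_⟩⟩
  obtain ⟨g, r, ι, hhyp, hpro, -⟩ := hS.vertex v F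
  exact h Sigma hS.sigma_primes.1 hS.sigma_primes.2 g r hhyp (Aut F) ι hpro

/-- The same, packaged as an implication between the named facts' shapes: `ProSigmaSurfaceGroupSlim`
yields the verticial-slimness conjunct of `example_2_10` for every semi-graph of anabelioids of surface
type. [cite: MochizukiSemiAnbd2006, Ex. 2.10 p.31] -/
theorem isVerticiallySlim_of_isOfSurfaceType (h : ProSigmaSurfaceGroupSlim.{max u₁ v₁}) :
    ∀ (𝒢 : SemiGraphOfAnabelioids.{v₁, u₁, u}) (Sigma : Set ℕ), 𝒢.IsOfSurfaceType Sigma →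
      𝒢.IsVerticiallySlim :=
  fun 𝒢 Sigma hS => example_2_10_verticiallySlim_of h 𝒢 Sigma hS

end SemiGraphOfAnabelioids

end Literature.AnabelianGeometry.SemiGraphs
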